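import Summits.QuantumFields.BalabanUV.T4Continuum.Spine.NE3.LandauProjectionSupCurved
import Summits.QuantumFields.BalabanUV.T4Continuum.Support.NE3RightInverseSupLetters
import HarnessLib

/-!
# T⁴ programme, node NE3 — census R40 (file (iv)b): (HR_W) AT A CURVED BACKGROUND OF THE MULTI-LEVEL CLASS WITH A LEVEL-FREE CONSTANT

Cell `pub-balaban-gaps` (YM blitz, track G2, seat `ne3`, unit `pub-balaban-gaps-ne3-g9`; writer prover-pub-balaban-gaps-ne3-g9-0, 2026-08-25), census
`run/shared/lean/pub/pub-balaban-gaps/ne/NE3.md` §4 R40, §15.  WHY.  `LandauProjectionSupCurved.covLapSite_sup_le_curved` proves (HR_W) — the `ℓ^∞` bound of B8's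
(1.38)-projection onto `Δ_W N(Q′(W))` — at a curved background with EXPLICIT averaging∕gauge radii `R, R′, r`.  THIS FILE makes the choice `R′ = M`, `R = ⌊M∕(64d²)⌋`,
`r = 64d²` and shows that under two LEVEL-FREE smallness conditions the constant is INDEPENDENT of `j` and `L`:

* §1 `mvLine_of_small`, `curvedConst_le`, `radius_facts` — real∕natural arithmetic: the choice meets the two lines of `CovariantMeanValue.sup_le_meanValue` as soon as
  `256d²·M²x ≤ 1` and `16d·M³x₁ ≤ 1`, and then the constant is `≤ 1 + 2·card n·(64d²N)^d + 27(card n)³512^dN^d`.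
* §2 **`covLapSite_sup_le_curved_uniform`** — (HR_W) AT A CURVED BACKGROUND OF THE CLASS WITH THE LEVEL-FREE CONSTANT
  `c_R = 1 + 2·card n·(64d²N)^d + 27·(card n)³·512^d·N^d` ⇐ `SmallField W x` ∧ plaquette gradients `≤ x₁` ∧ `256d²M²x ≤ 1` ∧ `16dM³x₁ ≤ 1`;
  **`hRW_of_radii`** — the same in the binder shape `hRW` of gen 8's capstones (`SupRegularityCurvedUniform.landauCorrectionSupB8_uniform`,
  `LandauCorrectionSupB8Cavg.landauCorrectionSupB8_cavg`), from THEIR two level-free lines (`23040d⁴(frameC+d)²M²x ≤ 1`, `11520d⁴(frameC+d)³M³x₁ ≤ 1`); the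
  companion `LandauCorrectionSupB8Curved` does the plugging.

CONTENT (0 sorry; no `def`; [folklore] lattice analysis).  HONEST FRAMING.  A statement about ONE background of the multi-level small-field class given two regularity
radii; nothing of Bałaban's asserted; (P♮) at curved `W`, `PairLandauGaugeB8Avg`, the covariant root and **NE3 are NOT proved**; spine PROVED 0∕9; finite T⁴ rung (B)+1 —
NOT infinite volume, NOT mass gap, NOT `BetaPertH`, NOT Clay.  PLACEMENT: `Summits/QuantumFields/BalabanUV/T4Continuum/Spine/NE3/`; imports accepted modules only;
moves nothing.  HONEST DEPENDENCY (cell page 1): continuum YM on T⁴ ⇐ BetaPertH ∧ nine spine estimates (0/9 proved); BetaPertH ⇐ (D1) ∧ (D4) ∧ CAP+tail.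
-/

set_option autoImplicit false

open scoped BigOperators Matrix Matrix.Norms.L2Operator
open NormedSpace Finset

namespace Summit.QuantumFields.BalabanUV.T4Continuum.NE3.LandauProjectionSupCurvedUniform

open Literature.MathematicalPhysics.QuantumFieldTheory.Balaban1983to89
open B7Prop1Explicit B7Prop2Explicit MatrixNorms
open T4AveragingDeficitWall (Ad IsUnitaryCfg SmallField)
open T4AveragingDeficitWallBoundary (IsPeriodicCfg periodBox)
open AveragingDeficitMultiLevelPrep (LevelSmall)
open NE3NestedMeanBlockOperator (tentMean tentMean_pos inv_le_tentMean)
open NE3CovariantCalculus (hsR)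
open NE3RightInverseSupLetters (frameC)
open NE3.PairLandauB8 (avgKernelGauges covLapSite)
open NE3.LandauProjectionSupCurved (covLapSite_sup_le_curved)

noncomputable section

variable {d : ℕ} {n : Type*} [Fintype n] [DecidableEq n]

/-! ## §1 Arithmetic of the radii -/

set_option maxHeartbeats 400000 in
omit [Fintype n] [DecidableEq n] in
/-- **THE TWO MEAN-VALUE LINES FROM TWO LEVEL-FREE SMALLNESS CONDITIONS**: with gauge radius `R′ = M` and an averaging radius `ρ` with `64d²ρ ≤ M`,
`256d²·M²x ≤ 1` and `16d·M³x₁ ≤ 1` give `16Md·a ≤ 1∕2` and `4dρ(2d∕M + 4Mδ + 24Mda² + 2a) ≤ 1∕2` (`a = 2d(M+1)x`, `δ = 2d²(M+1)x₁ + 8d³(M+1)²x²`). [folklore] -/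
theorem mvLine_of_small (hd : 1 ≤ d) {M ρ x x₁ : ℝ} (hM : 2 ≤ M) (hρ : 64 * (d : ℝ) ^ 2 * ρ ≤ M)
    (hx : 0 ≤ x) (hx₁ : 0 ≤ x₁) (hbx : 256 * (d : ℝ) ^ 2 * M ^ 2 * x ≤ 1) (hcx : 16 * (d : ℝ) * M ^ 3 * x₁ ≤ 1) :
    16 * M * d * (2 * (d : ℝ) * (M + 1) * x) ≤ 1 / 2 ∧
    4 * (d : ℝ) * ρ * (2 * (d : ℝ) / M + 4 * M * (2 * (d : ℝ) ^ 2 * (M + 1) * x₁ + 8 * (d : ℝ) ^ 3 * (M + 1) ^ 2 * x ^ 2)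
        + 24 * M * d * (2 * (d : ℝ) * (M + 1) * x) ^ 2 + 2 * (2 * (d : ℝ) * (M + 1) * x)) ≤ 1 / 2 := by
  have hd1 : (1 : ℝ) ≤ d := by exact_mod_cast hd
  have hd0 : (0 : ℝ) < d := by linarith
  have hM0 : 0 < M := by linarith
  have hM1 : M + 1 ≤ 2 * M := by linarith
  -- the level-free letters `e = M²x`, `k = M³x₁`
  set e : ℝ := M ^ 2 * x with he_def
  set k : ℝ := M ^ 3 * x₁ with hk_def
  have he0 : 0 ≤ e := by positivity
  have hk0 : 0 ≤ k := by positivity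
  have hde : (d : ℝ) ^ 2 * e ≤ 1 / 256 := by rw [he_def]; nlinarith [hbx]
  have he1 : e ≤ 1 / 256 := by
    have h1 : 1 * e ≤ (d : ℝ) ^ 2 * e := mul_le_mul_of_nonneg_right (one_le_pow₀ hd1) he0
    linarith
  have hdk : (d : ℝ) * k ≤ 1 / 16 := by rw [hk_def]; nlinarith [hcx]
  -- the letters `a`, `δ`
  set a : ℝ := 2 * (d : ℝ) * (M + 1) * x with ha_def
  set δ : ℝ := 2 * (d : ℝ) ^ 2 * (M + 1) * x₁ + 8 * (d : ℝ) ^ 3 * (M + 1) ^ 2 * x ^ 2 with hδ_def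
  have ha0 : 0 ≤ a := by positivity
  have hδ0 : 0 ≤ δ := by positivity
  have haM : a ≤ 4 * (d : ℝ) * M * x := by
    rw [ha_def]; nlinarith [mul_nonneg hd0.le hx]
  have haMe : a * M ≤ 4 * (d : ℝ) * e := by
    rw [he_def]; nlinarith [haM, hM0.le]
  have hM2a2 : M ^ 2 * a ^ 2 ≤ 16 * (d : ℝ) ^ 2 * e ^ 2 := by
    have h1 : (a * M) ^ 2 ≤ (4 * (d : ℝ) * e) ^ 2 := pow_le_pow_left₀ (by positivity) haMe 2
    nlinarith [h1]
  have hM2δ : M ^ 2 * δ ≤ 4 * (d : ℝ) ^ 2 * k + 32 * (d : ℝ) ^ 3 * e ^ 2 := by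
    have h1 : M ^ 2 * ((M + 1) * x₁) ≤ 2 * k := by
      rw [hk_def]; nlinarith [mul_nonneg (sq_nonneg M) hx₁]
    have h2 : M ^ 2 * ((M + 1) ^ 2 * x ^ 2) ≤ 4 * e ^ 2 := by
      have h3 : (M + 1) ^ 2 ≤ (2 * M) ^ 2 := pow_le_pow_left₀ (by linarith) hM1 2
      have h4 : M ^ 2 * ((M + 1) ^ 2 * x ^ 2) ≤ M ^ 2 * ((2 * M) ^ 2 * x ^ 2) :=
        mul_le_mul_of_nonneg_left (mul_le_mul_of_nonneg_right h3 (sq_nonneg x)) (sq_nonneg M)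
      have e4 : M ^ 2 * ((2 * M) ^ 2 * x ^ 2) = 4 * e ^ 2 := by rw [he_def]; ring
      linarith
    have e0 : M ^ 2 * δ = 2 * (d : ℝ) ^ 2 * (M ^ 2 * ((M + 1) * x₁)) + 8 * (d : ℝ) ^ 3 * (M ^ 2 * ((M + 1) ^ 2 * x ^ 2)) := by
      rw [hδ_def]; ring
    rw [e0]
    have hd2 : (0 : ℝ) ≤ 2 * (d : ℝ) ^ 2 := by positivity
    have hd3 : (0 : ℝ) ≤ 8 * (d : ℝ) ^ 3 := by positivity
    nlinarith [mul_le_mul_of_nonneg_left h1 hd2, mul_le_mul_of_nonneg_left h2 hd3]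
  -- `e² ≤ e/256`, hence the `d³e²` terms are tiny
  have he2 : e ^ 2 ≤ e / 256 := by nlinarith [he1, he0]
  have hd3e2 : (d : ℝ) ^ 3 * e ^ 2 ≤ d / 65536 := by
    have h1 : (d : ℝ) ^ 3 * e ^ 2 ≤ (d : ℝ) ^ 3 * (e / 256) := mul_le_mul_of_nonneg_left he2 (by positivity)
    have h2 : (d : ℝ) ^ 3 * (e / 256) = d * ((d : ℝ) ^ 2 * e) / 256 := by ring
    have h3 : (d : ℝ) * ((d : ℝ) ^ 2 * e) ≤ d * (1 / 256) := mul_le_mul_of_nonneg_left hde hd0.le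
    linarith
  constructor
  · -- `16Md·a = 32d²(M²x + Mx) ≤ 64d²e ≤ 1/4`
    have h1 : M * x ≤ e := by rw [he_def]; nlinarith [mul_nonneg hM0.le hx]
    have e1 : 16 * M * d * (2 * (d : ℝ) * (M + 1) * x) = 32 * ((d : ℝ) ^ 2 * e) + 32 * (d : ℝ) ^ 2 * (M * x) := by rw [he_def]; ring
    rw [e1]
    have h2 : 32 * (d : ℝ) ^ 2 * (M * x) ≤ 32 * ((d : ℝ) ^ 2 * e) := by nlinarith [h1, sq_nonneg (d : ℝ)]
    linarith
  · -- `4dρ·S·16d ≤ M·S = 2d + 4M²δ + 24dM²a² + 2aM ≤ 8d`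
    set S : ℝ := 2 * (d : ℝ) / M + 4 * M * δ + 24 * M * d * a ^ 2 + 2 * a with hS_def
    have hS0 : 0 ≤ S := by positivity
    have hMne : M ≠ 0 := hM0.ne'
    have hMS : M * S ≤ 8 * d := by
      have e1 : M * S = 2 * d + 4 * (M ^ 2 * δ) + 24 * d * (M ^ 2 * a ^ 2) + 2 * (a * M) := by
        rw [hS_def]; field_simp
      rw [e1]
      have hdk' : (d : ℝ) ^ 2 * k ≤ d / 16 := by
        have := mul_le_mul_of_nonneg_left hdk hd0.le
        have e2 : (d : ℝ) * ((d : ℝ) * k) = (d : ℝ) ^ 2 * k := by ring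
        linarith [e2]
      have p1 : (d : ℝ) * (M ^ 2 * a ^ 2) ≤ d * (16 * (d : ℝ) ^ 2 * e ^ 2) := mul_le_mul_of_nonneg_left hM2a2 hd0.le
      have p2 : (d : ℝ) * e ≤ d * (1 / 256) := mul_le_mul_of_nonneg_left he1 hd0.le
      have e3 : (d : ℝ) * (16 * (d : ℝ) ^ 2 * e ^ 2) = 16 * ((d : ℝ) ^ 3 * e ^ 2) := by ring
      have e4 : 24 * (d : ℝ) * (M ^ 2 * a ^ 2) = 24 * ((d : ℝ) * (M ^ 2 * a ^ 2)) := by ring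
      have e5 : 2 * (a * M) ≤ 8 * ((d : ℝ) * e) := by linarith [haMe]
      rw [e4]
      linarith [hM2δ, hd3e2, hdk', p1, p2, e3, e5, hd1]
    have h1 : (4 * (d : ℝ) * ρ * S) * (16 * d) ≤ 1 / 2 * (16 * d) :=
      calc (4 * (d : ℝ) * ρ * S) * (16 * d) = (64 * (d : ℝ) ^ 2 * ρ) * S := by ring
        _ ≤ M * S := mul_le_mul_of_nonneg_right hρ hS0
        _ ≤ 8 * d := hMS
        _ = 1 / 2 * (16 * d) := by ring
    have h16 : (0 : ℝ) < 16 * d := by positivity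
    exact le_of_mul_le_mul_right h1 h16

omit [Fintype n] [DecidableEq n] in
/-- **THE CURVED CONSTANT IS LEVEL-FREE**: with `64d²R ≤ M`, `256d²M²x ≤ 1`, `κ = 1∕M + 2(d−1)(M−1)x` (so `κM ≤ 2`), `8^{−d} ≤ tm` and `cn ≥ 1`:
`24·d·R·M·cn²·(18·d·cn·κ²∕tm²)·N_d∕tm ≤ 27·cn³·512^d·N_d`. [folklore] -/
theorem curvedConst_le (hd : 1 ≤ d) {M R x κ tm cn Nd : ℝ} (hM : 2 ≤ M) (hR : 64 * (d : ℝ) ^ 2 * R ≤ M) (hx : 0 ≤ x)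
    (hbx : 256 * (d : ℝ) ^ 2 * M ^ 2 * x ≤ 1) (hκ : κ = 1 / M + 2 * (((d : ℝ) - 1) * (M - 1) * x)) (htm0 : 0 < tm)
    (htm : ((8 : ℝ) ^ d)⁻¹ ≤ tm) (hcn : 1 ≤ cn) (hNd : 0 ≤ Nd) :
    24 * (d : ℝ) * R * M * cn ^ 2 * (18 * (d : ℝ) * cn * κ ^ 2 / tm ^ 2) * Nd / tm ≤ 27 * cn ^ 3 * (512 : ℝ) ^ d * Nd := by
  have hd1 : (1 : ℝ) ≤ d := by exact_mod_cast hd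
  have hd0 : (0 : ℝ) < d := by linarith
  have hM0 : 0 < M := by linarith
  have hMne : M ≠ 0 := hM0.ne'
  have htne : tm ≠ 0 := htm0.ne'
  have hcn0 : 0 ≤ cn := by linarith
  have hdm : 0 ≤ ((d : ℝ) - 1) * (M - 1) * x := mul_nonneg (mul_nonneg (by linarith) (by linarith)) hx
  have hκ0 : 0 ≤ κ := by rw [hκ]; positivity
  -- `κ·M ≤ 2`
  have hκM : κ * M ≤ 2 := by
    have e1 : κ * M = 1 + 2 * (((d : ℝ) - 1) * (M - 1) * (M * x)) := by rw [hκ]; field_simp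
    rw [e1]
    have h1 : ((d : ℝ) - 1) * (M - 1) * (M * x) ≤ d * (M ^ 2 * x) := by
      have hMx : 0 ≤ M * x := mul_nonneg hM0.le hx
      have h2 : ((d : ℝ) - 1) * (M - 1) ≤ d * M := by nlinarith
      have h3 : ((d : ℝ) - 1) * (M - 1) * (M * x) ≤ d * M * (M * x) := mul_le_mul_of_nonneg_right h2 hMx
      have e2 : (d : ℝ) * M * (M * x) = d * (M ^ 2 * x) := by ring
      linarith
    have h2 : (d : ℝ) * (M ^ 2 * x) ≤ 1 / 256 := by
      have h3 : (d : ℝ) * (M ^ 2 * x) ≤ (d : ℝ) ^ 2 * (M ^ 2 * x) :=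
        mul_le_mul_of_nonneg_right (by nlinarith) (by positivity)
      nlinarith [hbx]
    linarith
  have hκ2 : κ ^ 2 * M ^ 2 ≤ 4 := by
    have h1 : (κ * M) ^ 2 ≤ 2 ^ 2 := pow_le_pow_left₀ (by positivity) hκM 2
    nlinarith [h1]
  -- `R·M·κ² ≤ 1/(16d²)`
  have hRM : R * M * κ ^ 2 ≤ 1 / (16 * (d : ℝ) ^ 2) := by
    have e1 : R * M * κ ^ 2 = R / M * (κ ^ 2 * M ^ 2) := by field_simp
    rw [e1]
    have h2 : R / M ≤ 1 / (64 * (d : ℝ) ^ 2) := by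
      rw [div_le_div_iff₀ hM0 (by positivity)]; linarith
    calc R / M * (κ ^ 2 * M ^ 2) ≤ 1 / (64 * (d : ℝ) ^ 2) * 4 := mul_le_mul h2 hκ2 (by positivity) (by positivity)
      _ = 1 / (16 * (d : ℝ) ^ 2) := by ring
  -- `tm⁻¹ ≤ 8^d`
  have htinv : tm⁻¹ ≤ (8 : ℝ) ^ d := inv_le_of_inv_le₀ (by positivity) htm
  have htinv3 : (tm⁻¹) ^ 3 ≤ ((8 : ℝ) ^ d) ^ 3 := pow_le_pow_left₀ (inv_nonneg.2 htm0.le) htinv 3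
  have e8 : ((8 : ℝ) ^ d) ^ 3 = (512 : ℝ) ^ d := by rw [← pow_mul, show (512 : ℝ) = 8 ^ 3 by norm_num, ← pow_mul, mul_comm]
  have eT : 24 * (d : ℝ) * R * M * cn ^ 2 * (18 * (d : ℝ) * cn * κ ^ 2 / tm ^ 2) * Nd / tm
      = 432 * (d : ℝ) ^ 2 * cn ^ 3 * Nd * (R * M * κ ^ 2) * (tm⁻¹) ^ 3 := by
    field_simp; ring
  rw [eT]
  calc 432 * (d : ℝ) ^ 2 * cn ^ 3 * Nd * (R * M * κ ^ 2) * (tm⁻¹) ^ 3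
      ≤ 432 * (d : ℝ) ^ 2 * cn ^ 3 * Nd * (1 / (16 * (d : ℝ) ^ 2)) * ((8 : ℝ) ^ d) ^ 3 := by gcongr
    _ = 27 * cn ^ 3 * (512 : ℝ) ^ d * Nd := by rw [e8]; field_simp; ring

omit [Fintype n] [DecidableEq n] in
/-- **THE AVERAGING RADIUS `R = ⌊M∕(64d²)⌋`** (`M ≥ 2`, `d ≥ 1`): `M ≤ 64d²·(2R+1)`, `2R+1 ≤ M`, `64d²R ≤ M`. [folklore] -/
theorem radius_facts (hd : 1 ≤ d) {M : ℕ} (hM : 2 ≤ M) :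
    (M : ℝ) ≤ ((64 * d ^ 2 : ℕ) : ℝ) * (2 * ((M / (64 * d ^ 2) : ℕ) : ℝ) + 1) ∧
    2 * (M / (64 * d ^ 2)) + 1 ≤ M ∧
    64 * (d : ℝ) ^ 2 * ((M / (64 * d ^ 2) : ℕ) : ℝ) ≤ M := by
  have hd2 : 1 ≤ d ^ 2 := Nat.one_le_pow _ _ hd
  have hq : 0 < 64 * d ^ 2 := by positivity
  have hq64 : 64 ≤ 64 * d ^ 2 := by nlinarith
  refine ⟨?_, ?_, ?_⟩
  · have h1 : M < 64 * d ^ 2 * (M / (64 * d ^ 2) + 1) := Nat.lt_mul_div_succ M hq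
    have h2 : M ≤ 64 * d ^ 2 * (2 * (M / (64 * d ^ 2)) + 1) := le_trans h1.le (Nat.mul_le_mul_left _ (by omega))
    exact_mod_cast h2
  · have h1 : M / (64 * d ^ 2) ≤ M / 64 := Nat.div_le_div_left hq64 (by norm_num)
    omega
  · have h1 : M / (64 * d ^ 2) * (64 * d ^ 2) ≤ M := Nat.div_mul_le_self M _
    have h2 : ((M / (64 * d ^ 2) * (64 * d ^ 2) : ℕ) : ℝ) ≤ M := by exact_mod_cast h1
    push_cast at h2
    linarith

/-! ## §2 (HR_W) with a level-free constant -/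

/-- **(HR_W) AT A CURVED BACKGROUND OF THE CLASS WITH A LEVEL-FREE CONSTANT** (`d ≥ 1`, `L ≥ 2`, `N ≥ 1`, `j`; `M = L^{j+1}`): for unitary `(N·M)`-periodic `W`
with `LevelSmall d L j x`, `SmallField W x`, covariant plaquette gradients `≤ x₁`, and the two LEVEL-FREE lines `256d²·M²x ≤ 1`, `16d·M³x₁ ≤ 1`: for skew periodic
`F` with `‖F‖_∞ ≤ B`, `μ ∈ N(Q′(W))` with `F + Δ_Wμ ⊥ Δ_W N(Q′(W))`, and every `y`,
`‖Δ_Wμ(y)‖ ≤ (1 + 2·card n·(64d²N)^d + 27·(card n)³·512^d·N^d)·B` — INDEPENDENT of `j`, `L`, `x`, `x₁`. [folklore] -/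
theorem covLapSite_sup_le_curved_uniform [Nonempty n] (hd : 1 ≤ d) {L N : ℕ} (hL : 2 ≤ L) (hN : 1 ≤ N) (j : ℕ)
    {W : Site d → Fin d → (Matrix n n ℂ)ˣ} {x x₁ : ℝ} (hWu : IsUnitaryCfg W) (hWP : IsPeriodicCfg W ((N * L ^ (j + 1) : ℕ) : ℤ))
    (hx : 0 ≤ x) (hs : LevelSmall d L j x) (hWx : SmallField W x) (hx10 : 0 ≤ x₁)
    (hgrad : ∀ (p : Site d) (μ κ : Fin d), κ ≠ μ →
      ‖Ad (W p μ) ((hol W (p + e μ) (plaqWord κ μ) : (Matrix n n ℂ)ˣ) : Matrix n n ℂ) - ((hol W p (plaqWord κ μ) : (Matrix n n ℂ)ˣ) : Matrix n n ℂ)‖ ≤ x₁)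
    (hbx : 256 * (d : ℝ) ^ 2 * ((L : ℝ) ^ (j + 1)) ^ 2 * x ≤ 1) (hcx : 16 * (d : ℝ) * ((L : ℝ) ^ (j + 1)) ^ 3 * x₁ ≤ 1)
    (F : Site d → Matrix n n ℂ) (hFs : ∀ y : Site d, F y ∈ skewAdjoint (Matrix n n ℂ))
    (hFP : ∀ (y : Site d) (i : Fin d), F (y + ((N * L ^ (j + 1) : ℕ) : ℤ) • e i) = F y)
    {mu : Site d → Matrix n n ℂ} (hmu : mu ∈ avgKernelGauges (d := d) (n := n) L N (j + 1) W)
    (horth : ∀ nu ∈ avgKernelGauges (d := d) (n := n) L N (j + 1) W,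
      ∑ y ∈ periodBox (d := d) (N * L ^ (j + 1)), hsR (F y + covLapSite W mu y) (covLapSite W nu y) = 0)
    {B : ℝ} (hFB : ∀ y : Site d, ‖F y‖ ≤ B) (y : Site d) :
    ‖covLapSite W mu y‖
      ≤ (1 + 2 * (Fintype.card n : ℝ) * (64 * (d : ℝ) ^ 2 * N) ^ d + 27 * (Fintype.card n : ℝ) ^ 3 * (512 : ℝ) ^ d * (N : ℝ) ^ d) * B := by
  have hL1 : 1 ≤ L := by omega
  set M : ℕ := L ^ (j + 1) with hM_def
  have hM2 : 2 ≤ M := le_trans hL (Nat.le_self_pow (by omega) L)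
  have hMr : ((M : ℕ) : ℝ) = (L : ℝ) ^ (j + 1) := by rw [hM_def]; push_cast; ring
  have hM2r : (2 : ℝ) ≤ (L : ℝ) ^ (j + 1) := by rw [← hMr]; exact_mod_cast hM2
  have hB0 : 0 ≤ B := (norm_nonneg _).trans (hFB 0)
  obtain ⟨hRr, hRP, hRle⟩ := radius_facts hd hM2
  set R : ℕ := M / (64 * d ^ 2) with hR_def
  -- the two mean-value lines with `R′ = M`, `ρ = R`
  have hRle' : 64 * (d : ℝ) ^ 2 * (R : ℝ) ≤ (L : ℝ) ^ (j + 1) := by rw [← hMr]; exact hRle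
  obtain ⟨ha, hline⟩ := mvLine_of_small hd hM2r hRle' hx hx10 hbx hcx
  have hRP' : 2 * R + 1 ≤ N * L ^ (j + 1) := le_trans hRP (Nat.le_mul_of_pos_left _ (by omega))
  have hr1 : 1 ≤ 64 * d ^ 2 := le_trans hd (by nlinarith [Nat.one_le_pow 2 d hd])
  have hRr' : ((L ^ (j + 1) : ℕ) : ℝ) ≤ ((64 * d ^ 2 : ℕ) : ℝ) * (2 * (R : ℝ) + 1) := hRr
  have hM1r : ((M : ℕ) : ℝ) = ((L ^ (j + 1) : ℕ) : ℝ) := by rw [hM_def]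
  have h := covLapSite_sup_le_curved hd hL hN j hWu hWP hx hs hWx hx10 hgrad (R := R) (R' := L ^ (j + 1)) (r := 64 * d ^ 2)
    (Nat.one_le_pow _ _ hL1) hr1 hRr' hRP' (by push_cast; exact ha) (by push_cast; exact hline) F hFs hFP hmu horth hFB y
  refine h.trans (mul_le_mul_of_nonneg_right ?_ hB0)
  -- the constant
  have hcn1 : (1 : ℝ) ≤ (Fintype.card n : ℝ) := by exact_mod_cast Fintype.card_pos
  have hconst := curvedConst_le hd (cn := (Fintype.card n : ℝ)) (Nd := (N : ℝ) ^ d) (R := (R : ℝ)) hM2r hRle' hx hbx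
    (κ := 1 / (((L ^ (j + 1) : ℕ) : ℝ)) + 2 * (((d : ℝ) - 1) * ((((L ^ (j + 1) : ℕ) : ℝ)) - 1) * x)) (by push_cast; ring)
    (tentMean_pos hM2 d) (inv_le_tentMean hM2 d) hcn1 (by positivity)
  have e1 : (2 : ℝ) * (Fintype.card n : ℝ) * ((N : ℝ) * ((64 * d ^ 2 : ℕ) : ℝ)) ^ d = 2 * (Fintype.card n : ℝ) * (64 * (d : ℝ) ^ 2 * N) ^ d := by
    push_cast; ring
  have e2 : (24 : ℝ) * d * (R : ℝ) * ((L ^ (j + 1) : ℕ) : ℝ) * (Fintype.card n : ℝ) ^ 2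
        * (18 * (d : ℝ) * (Fintype.card n : ℝ) * (1 / (((L ^ (j + 1) : ℕ) : ℝ)) + 2 * (((d : ℝ) - 1) * ((((L ^ (j + 1) : ℕ) : ℝ)) - 1) * x)) ^ 2
            / tentMean d (L ^ (j + 1)) ^ 2) * (N : ℝ) ^ d / tentMean d (L ^ (j + 1))
      = 24 * (d : ℝ) * (R : ℝ) * (L : ℝ) ^ (j + 1) * (Fintype.card n : ℝ) ^ 2
        * (18 * (d : ℝ) * (Fintype.card n : ℝ) * (1 / (((L ^ (j + 1) : ℕ) : ℝ)) + 2 * (((d : ℝ) - 1) * ((((L ^ (j + 1) : ℕ) : ℝ)) - 1) * x)) ^ 2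
            / tentMean d (L ^ (j + 1)) ^ 2) * (N : ℝ) ^ d / tentMean d (L ^ (j + 1)) := by
    push_cast; ring
  linarith [hconst, e1, e2]

/-- **(HR_W) IN THE BINDER SHAPE OF GEN 8's CAPSTONES, FROM THEIR TWO LEVEL-FREE LINES** (`23040d⁴(frameC+d)²M²x ≤ 1`, `11520d⁴(frameC+d)³M³x₁ ≤ 1` imply
`256d²M²x ≤ 1`, `16dM³x₁ ≤ 1`). [folklore] -/
theorem hRW_of_radii [Nonempty n] (hd : 1 ≤ d) {L N : ℕ} [NeZero N] (hL : 2 ≤ L) (j : ℕ)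
    {W : Site d → Fin d → (Matrix n n ℂ)ˣ} {x x₁ : ℝ} (hWu : IsUnitaryCfg W) (hWP : IsPeriodicCfg W ((N * L ^ (j + 1) : ℕ) : ℤ))
    (hx : 0 ≤ x) (hs : LevelSmall d L j x) (hWx : SmallField W x) (hx10 : 0 ≤ x₁)
    (hgrad : ∀ (p : Site d) (μ κ : Fin d), κ ≠ μ →
      ‖Ad (W p μ) ((hol W (p + e μ) (plaqWord κ μ) : (Matrix n n ℂ)ˣ) : Matrix n n ℂ) - ((hol W p (plaqWord κ μ) : (Matrix n n ℂ)ˣ) : Matrix n n ℂ)‖ ≤ x₁)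
    (hbx : 23040 * (d : ℝ) ^ 4 * (frameC d L + d) ^ 2 * ((L : ℝ) ^ (j + 1)) ^ 2 * x ≤ 1)
    (hcx : 11520 * (d : ℝ) ^ 4 * (frameC d L + d) ^ 3 * ((L : ℝ) ^ (j + 1)) ^ 3 * x₁ ≤ 1) :
    ∀ (F : Site d → Matrix n n ℂ), (∀ y : Site d, F y ∈ skewAdjoint (Matrix n n ℂ)) →
      (∀ (y : Site d) (i : Fin d), F (y + ((N * L ^ (j + 1) : ℕ) : ℤ) • e i) = F y) →
      ∀ μ ∈ avgKernelGauges (d := d) (n := n) L N (j + 1) W,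
        (∀ ν ∈ avgKernelGauges (d := d) (n := n) L N (j + 1) W,
          ∑ y ∈ periodBox (d := d) (N * L ^ (j + 1)), hsR (F y + covLapSite W μ y) (covLapSite W ν y) = 0) →
        ∀ B : ℝ, (∀ y : Site d, ‖F y‖ ≤ B) → ∀ y : Site d, ‖covLapSite W μ y‖
          ≤ (1 + 2 * (Fintype.card n : ℝ) * (64 * (d : ℝ) ^ 2 * N) ^ d + 27 * (Fintype.card n : ℝ) ^ 3 * (512 : ℝ) ^ d * (N : ℝ) ^ d) * B := by
  have hd1 : (1 : ℝ) ≤ d := by exact_mod_cast hd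
  have hF1 : (1 : ℝ) ≤ frameC d L + d := by
    have h0 : 0 ≤ frameC d L := by unfold frameC; positivity
    linarith
  have hMx : 0 ≤ ((L : ℝ) ^ (j + 1)) ^ 2 * x := by positivity
  have hMx₁ : 0 ≤ ((L : ℝ) ^ (j + 1)) ^ 3 * x₁ := by positivity
  -- `256d² ≤ 23040d⁴F²` and `16d ≤ 11520d⁴F³`
  have hd2 : (d : ℝ) ^ 2 ≤ (d : ℝ) ^ 4 := pow_le_pow_right₀ hd1 (by norm_num)
  have hd4 : (d : ℝ) ≤ (d : ℝ) ^ 4 := le_self_pow₀ hd1 (by norm_num)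
  have hF2 : (1 : ℝ) ≤ (frameC d L + d) ^ 2 := one_le_pow₀ hF1
  have hF3 : (1 : ℝ) ≤ (frameC d L + d) ^ 3 := one_le_pow₀ hF1
  have hbx' : 256 * (d : ℝ) ^ 2 * ((L : ℝ) ^ (j + 1)) ^ 2 * x ≤ 1 := by
    have h1 : (d : ℝ) ^ 2 * 1 ≤ (d : ℝ) ^ 4 * (frameC d L + d) ^ 2 := mul_le_mul hd2 hF2 (by norm_num) (by positivity)
    have h2 : 256 * ((d : ℝ) ^ 2 * 1) * (((L : ℝ) ^ (j + 1)) ^ 2 * x) ≤ 23040 * ((d : ℝ) ^ 4 * (frameC d L + d) ^ 2) * (((L : ℝ) ^ (j + 1)) ^ 2 * x) := by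
      gcongr; norm_num
    linarith
  have hcx' : 16 * (d : ℝ) * ((L : ℝ) ^ (j + 1)) ^ 3 * x₁ ≤ 1 := by
    have h1 : (d : ℝ) * 1 ≤ (d : ℝ) ^ 4 * (frameC d L + d) ^ 3 := mul_le_mul hd4 hF3 (by norm_num) (by positivity)
    have h2 : 16 * ((d : ℝ) * 1) * (((L : ℝ) ^ (j + 1)) ^ 3 * x₁) ≤ 11520 * ((d : ℝ) ^ 4 * (frameC d L + d) ^ 3) * (((L : ℝ) ^ (j + 1)) ^ 3 * x₁) := by
      gcongr; norm_num
    linarith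
  intro F hFs hFP μ hμ horth B hFB y
  exact covLapSite_sup_le_curved_uniform hd hL (Nat.one_le_iff_ne_zero.mpr (NeZero.ne N)) j hWu hWP hx hs hWx hx10 hgrad hbx' hcx' F hFs hFP hμ horth hFB y

end

end Summit.QuantumFields.BalabanUV.T4Continuum.NE3.LandauProjectionSupCurvedUniform
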